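import Summits.QuantumFields.BalabanUV.Beta.GAN24.WoodburyFibreZeroModeGainEnd
import Summits.QuantumFields.BalabanUV.Beta.HessKerDressedUnits

/-!
# GAN24 / WoodburyFibreZeroModeGainUnits — the zero-mode gain for the UNIT-NORMALISED decimated resolvent `unitK s_f s_m (KInvStep Lc j)`
# (the kernel of the W-slot files, e.g. `GAN24/WSlotOfShapes`: `unitK (sfStep Lc j) (smStep d Lc j) (KInvStep Lc j)`): leg-type-constant units
# preserve the zero `Lc`-contour sums of the field–field block, so every gain of `…GainStep` ∕ `…GainEnd` holds verbatim for it
# (census row V14 of `HOME/b2b-balaban-gan24-p3/WOODBURY-FIBRE.md` v8; binder row G-an2-4 ∕ (CONV-C), P3, gen 8)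

Cell `pub-balaban`, β sub-cell.  HONEST FRAMING (verbatim): discharging `BetaPertH` makes Bałaban's UV stability UNCONDITIONAL — a real
constructive-QFT result; it is NOT the continuum limit and NOT the Clay problem.  HONEST DEPENDENCY (verbatim): continuum YM on T⁴ ⇐
BetaPertH ∧ nine spine estimates (0/9 proved); BetaPertH ⇐ (D1) ∧ (D4) ∧ CAP+tail; G-an2-4 gates asym, D1 and NE2/3/4.  NOT IN PRINT; OUR
BOOKKEEPING.  [folklore] over asym1's `HessKerDressedUnits.unitK` ∕ `legScale` and the companion files BY NAME; cites nothing, mints no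
`def … : Prop`, instantiates no wall binder; the units `s_f, s_m` are ARBITRARY reals here (the consumer takes `sfStep Lc j`, `smStep d Lc j`);
every `Decays` ∕ forward-difference datum is a HYPOTHESIS.  Discharges NOTHING of (CONV-C), the W-slot, «T2Shape», (D1); NEVER «G-an2-4
closed»; NOT BetaPertH, NOT continuum, NOT Clay.

## Contents (all [folklore]; `Γ := blockFF (unitK sf sm (KInvStep Lc j))`, contours of side `Lc` on the step-`j` lattice)
* `blockFF_unitK_inl_inl` (the field–field entries are `sf·K·sf`); **`contourSum_blockFF_unitKInvStep_left ∕ _right`** (zero contour sums on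
  both legs, every `j`, every `sf sm`);
* **`decays_comp_ffUnitKInvStep_right ∕ _left`**, **`decays_comp_comp_ffUnitKInvStep`** (the gains with references `contourRef Lc` ∕ `contourRefL Lc`);
* **`decays_comp_ffUnitKInvStep_of_fwdDiff ∕ _left`**, **`decays_comp_comp_ffUnitKInvStep_of_fwdDiff`** (turn-key: forward-difference bounds
  `ε` on the legs enter the constants linearly, `ω(ε) = (d+2)(Lc−1)·ε·e^{2δ(d+2)(Lc−1)}`).
-/

noncomputable section

open Finset
open scoped BigOperators
open Literature.MathematicalPhysics.QuantumFieldTheory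
open Literature.MathematicalPhysics.QuantumFieldTheory.Balaban1983to89
open Literature.MathematicalPhysics.QuantumFieldTheory.Balaban1983to89.Beta
open B12Sec2to5 (l1 l1_nonneg)
open ExpKernelCalculus (MKer Decays comp Zl)
open KernelWard (Bdd bdd_of_decays)
open Summit.QuantumFields.BalabanUV.Beta.TameKernelCalculus (Spr)
open AffineAveraging (contourSum unitVec)
open OneStepResolventKernel (Fib)
open OneStepKernelFamily (KInvStep)
open KernelSpecInstance (contourSum_smul)
open Summit.QuantumFields.BalabanUV.Beta.HessKerDressedUnits (unitK legScale unitK_apply legScale_inl legScale_inr)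
open Summit.QuantumFields.BalabanUV.Beta.GAN24.WoodburyFibreBlocks (blockFF)
open Summit.QuantumFields.BalabanUV.Beta.GAN24.WoodburyFibreZeroModeGain
open Summit.QuantumFields.BalabanUV.Beta.GAN24.WoodburyFibreZeroModeGainKInv
open Summit.QuantumFields.BalabanUV.Beta.GAN24.WoodburyFibreZeroModeOsc
open Summit.QuantumFields.BalabanUV.Beta.GAN24.WoodburyFibreZeroModeGainStep
open Summit.QuantumFields.BalabanUV.Beta.GAN24.WoodburyFibreZeroModeGainEnd

namespace Summit.QuantumFields.BalabanUV.Beta.GAN24.WoodburyFibreZeroModeGainUnits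

variable {d : ℕ} {Lc : ℕ} [NeZero Lc]

/-! ## §1 Leg-type-constant units preserve the zero contour sums of the field–field block -/

omit [NeZero Lc] in
/-- The field–field entries of `unitK sf sm K` are `sf · K · sf`. [folklore] -/
theorem blockFF_unitK_inl_inl (sf sm : ℝ) (K : MKer (d + 1) (Fib d)) (x y : Fin (d + 1) → ℤ) (κ l : Fin (d + 1)) :
    blockFF (unitK sf sm K) x y (Sum.inl κ) (Sum.inl l) = (sf * sf) * blockFF K x y (Sum.inl κ) (Sum.inl l) := by
  simp only [blockFF, unitK_apply, legScale_inl]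
  ring

/-- **LEFT ZERO MODES** of `blockFF (unitK sf sm (KInvStep Lc j))`: zero `Lc`-contour sums of every field column, every `j`. [folklore] -/
theorem contourSum_blockFF_unitKInvStep_left (sf sm : ℝ) (j : ℕ) (y' : Fin (d + 1) → ℤ) (b : Fib d) (κ : Fin (d + 1))
    (u : Fin (d + 1) → ℤ) :
    contourSum Lc (fun κ' x' => blockFF (unitK sf sm (KInvStep (d := d) Lc j)) x' y' (Sum.inl κ') b) κ u = 0 := by
  cases b with
  | inl l =>
      have e : (fun κ' x' => blockFF (unitK sf sm (KInvStep (d := d) Lc j)) x' y' (Sum.inl κ') (Sum.inl l))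
          = (sf * sf) • (fun κ' x' => blockFF (KInvStep (d := d) Lc j) x' y' (Sum.inl κ') (Sum.inl l)) := by
        funext κ' x'
        simp only [blockFF_unitK_inl_inl, Pi.smul_apply, smul_eq_mul]
      rw [e, contourSum_smul, Pi.smul_apply, Pi.smul_apply, contourSum_blockFF_KInvStep_left, smul_eq_mul, mul_zero]
  | inr l =>
      simp only [blockFF, contourSum, Finset.sum_const_zero]

/-- **RIGHT ZERO MODES** of `blockFF (unitK sf sm (KInvStep Lc j))`: zero `Lc`-contour sums of every field row, every `j`. [folklore] -/
theorem contourSum_blockFF_unitKInvStep_right (sf sm : ℝ) (j : ℕ) (x : Fin (d + 1) → ℤ) (a : Fib d) (κ : Fin (d + 1))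
    (u : Fin (d + 1) → ℤ) :
    contourSum Lc (fun κ' y => blockFF (unitK sf sm (KInvStep (d := d) Lc j)) x y a (Sum.inl κ')) κ u = 0 := by
  cases a with
  | inl l =>
      have e : (fun κ' y => blockFF (unitK sf sm (KInvStep (d := d) Lc j)) x y (Sum.inl l) (Sum.inl κ'))
          = (sf * sf) • (fun κ' y => blockFF (KInvStep (d := d) Lc j) x y (Sum.inl l) (Sum.inl κ')) := by
        funext κ' y
        simp only [blockFF_unitK_inl_inl, Pi.smul_apply, smul_eq_mul]
      rw [e, contourSum_smul, Pi.smul_apply, Pi.smul_apply, contourSum_blockFF_KInvStep_right, smul_eq_mul, mul_zero]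
  | inr l =>
      simp only [blockFF, contourSum, Finset.sum_const_zero]

/-! ## §2 The gains for the unit-normalised block -/

/-- **ONE-SIDED GAIN (right leg)** for `blockFF (unitK sf sm (KInvStep Lc j))`, references `contourRef Lc`. [folklore] -/
theorem decays_comp_ffUnitKInvStep_right (sf sm : ℝ) (j : ℕ) {J : MKer (d + 1) (Fib d)} {CΓ ω δ δ' B : ℝ}
    (hΓ : Decays (blockFF (unitK sf sm (KInvStep (d := d) Lc j))) CΓ δ) (hδ : 0 < δ) (hJ : Bdd J B)
    (hω : Decays (J - contourRef Lc J) ω δ) (hδ'0 : 0 ≤ δ') (hδ' : δ' < δ) :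
    Decays (comp (blockFF (unitK sf sm (KInvStep (d := d) Lc j))) J)
      ((Fintype.card (Fib d) : ℝ) * (CΓ * ω) * Zl (d + 1) (δ - δ')) δ' :=
  decays_comp_of_contourSum_eq_zero hΓ hδ hJ (fun x y a κ => blockFF_inr_right _ x y a κ)
    (fun x a κ u => contourSum_blockFF_unitKInvStep_right sf sm j x a κ u) hω hδ'0 hδ'

/-- **ONE-SIDED GAIN (left leg)** for `blockFF (unitK sf sm (KInvStep Lc j))`, references `contourRefL Lc`. [folklore] -/
theorem decays_comp_ffUnitKInvStep_left (sf sm : ℝ) (j : ℕ) {A : MKer (d + 1) (Fib d)} {CΓ ω δ δ' B : ℝ} (hA : Bdd A B)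
    (hΓ : Decays (blockFF (unitK sf sm (KInvStep (d := d) Lc j))) CΓ δ) (hδ : 0 < δ) (hω : Decays (A - contourRefL Lc A) ω δ)
    (hδ'0 : 0 ≤ δ') (hδ' : δ' < δ) :
    Decays (comp A (blockFF (unitK sf sm (KInvStep (d := d) Lc j))))
      ((Fintype.card (Fib d) : ℝ) * (ω * CΓ) * Zl (d + 1) (δ - δ')) δ' :=
  decays_comp_of_contourSum_eq_zero_left hA hΓ hδ (fun y z κ b => blockFF_inr_left _ y z κ b)
    (fun z b κ u => contourSum_blockFF_unitKInvStep_left sf sm j z b κ u) hω hδ'0 hδ'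

/-- **TWO-SIDED GAIN** for `blockFF (unitK sf sm (KInvStep Lc j))`. [folklore] -/
theorem decays_comp_comp_ffUnitKInvStep (sf sm : ℝ) (j : ℕ) {A B : MKer (d + 1) (Fib d)} {CA CΓ CB ωA ωB δ δ' δ'' : ℝ}
    (hA : Decays A CA δ) (hΓ : Decays (blockFF (unitK sf sm (KInvStep (d := d) Lc j))) CΓ δ) (hB : Decays B CB δ) (hCB : 0 ≤ CB)
    (hδ : 0 < δ) (hωA : Decays (A - contourRefL Lc A) ωA δ) (hωB : Decays (B - contourRef Lc B) ωB δ) (hωB0 : 0 ≤ ωB)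
    (hδ'0 : 0 < δ') (hδ' : δ' < δ) (hδ''0 : 0 ≤ δ'') (hδ'' : δ'' < δ') :
    Decays (comp (comp A (blockFF (unitK sf sm (KInvStep (d := d) Lc j)))) B)
      ((Fintype.card (Fib d) : ℝ) * (((Fintype.card (Fib d) : ℝ) * (ωA * CΓ) * Zl (d + 1) (δ - δ')) * ωB) *
        Zl (d + 1) (δ' - δ'')) δ'' := by
  have hΓs : Spr (blockFF (unitK sf sm (KInvStep (d := d) Lc j))) := ⟨CΓ, δ, hδ, hΓ⟩
  have hAb : Bdd A CA := bdd_of_decays hA hδ.le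
  have hBb : Bdd B CB := bdd_of_decays hB hδ.le
  refine decays_comp_comp_of_annihil hAb (bdd_contourRefL hAb) hΓ hδ hBb
    ⟨_, δ, hδ, decays_contourRef (N := Lc) hB hCB hδ.le⟩ ?_ ?_ hωA hωB hωB0 hδ'0 hδ' hδ''0 hδ''
  · exact comp_contourRefL_eq_zero hAb hΓs.tame.2.1 (fun y z κ b => blockFF_inr_left _ y z κ b)
      (fun z b κ u => contourSum_blockFF_unitKInvStep_left sf sm j z b κ u)
  · exact comp_contourRef_eq_zero hΓs.tame.1 hBb (fun x y a κ => blockFF_inr_right _ x y a κ)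
      (fun x a κ u => contourSum_blockFF_unitKInvStep_right sf sm j x a κ u)

/-! ## §3 Turn-key forms: forward-difference bounds on the legs -/

/-- **TURN-KEY (right leg)**: a forward-difference bound `ε` on the first variable of `J`. [folklore] -/
theorem decays_comp_ffUnitKInvStep_of_fwdDiff (sf sm : ℝ) (j : ℕ) {J : MKer (d + 1) (Fib d)} {CΓ CJ ε δ δ' : ℝ}
    (hΓ : Decays (blockFF (unitK sf sm (KInvStep (d := d) Lc j))) CΓ δ) (hδ : 0 < δ) (hJ : Decays J CJ δ) (hε : 0 ≤ ε)
    (hD : ∀ μ y z f b, |J (y + unitVec μ) z f b - J y z f b| ≤ ε * Real.exp (-δ * l1 (y - z))) (hδ'0 : 0 ≤ δ') (hδ' : δ' < δ) :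
    Decays (comp (blockFF (unitK sf sm (KInvStep (d := d) Lc j))) J)
      ((Fintype.card (Fib d) : ℝ) *
        (CΓ * ((((d : ℝ) + 2) * ((Lc : ℝ) - 1)) * ε * Real.exp (2 * δ * (((d : ℝ) + 2) * ((Lc : ℝ) - 1))))) *
          Zl (d + 1) (δ - δ')) δ' :=
  decays_comp_ffUnitKInvStep_right sf sm j hΓ hδ (bdd_of_decays hJ hδ.le) (decays_sub_contourRef (N := Lc) hε hδ.le hD) hδ'0 hδ'

/-- **TURN-KEY (left leg)**: a forward-difference bound `ε` on the second variable of `A`. [folklore] -/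
theorem decays_comp_ffUnitKInvStep_of_fwdDiff_left (sf sm : ℝ) (j : ℕ) {A : MKer (d + 1) (Fib d)} {CΓ CA ε δ δ' : ℝ}
    (hA : Decays A CA δ) (hΓ : Decays (blockFF (unitK sf sm (KInvStep (d := d) Lc j))) CΓ δ) (hδ : 0 < δ) (hε : 0 ≤ ε)
    (hD : ∀ μ x y a f, |A x (y + unitVec μ) a f - A x y a f| ≤ ε * Real.exp (-δ * l1 (x - y))) (hδ'0 : 0 ≤ δ') (hδ' : δ' < δ) :
    Decays (comp A (blockFF (unitK sf sm (KInvStep (d := d) Lc j))))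
      ((Fintype.card (Fib d) : ℝ) *
        (((((d : ℝ) + 2) * ((Lc : ℝ) - 1)) * ε * Real.exp (2 * δ * (((d : ℝ) + 2) * ((Lc : ℝ) - 1)))) * CΓ) *
          Zl (d + 1) (δ - δ')) δ' :=
  decays_comp_ffUnitKInvStep_left sf sm j (bdd_of_decays hA hδ.le) hΓ hδ (decays_sub_contourRefL (N := Lc) hε hδ.le hD) hδ'0 hδ'

/-- **TURN-KEY TWO-SIDED**: forward-difference bounds `ε_A`, `ε_B` on both legs. [folklore] -/
theorem decays_comp_comp_ffUnitKInvStep_of_fwdDiff (sf sm : ℝ) (j : ℕ) {A B : MKer (d + 1) (Fib d)}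
    {CA CΓ CB εA εB δ δ' δ'' : ℝ} (hA : Decays A CA δ) (hΓ : Decays (blockFF (unitK sf sm (KInvStep (d := d) Lc j))) CΓ δ)
    (hB : Decays B CB δ) (hCB : 0 ≤ CB) (hδ : 0 < δ) (hεA : 0 ≤ εA) (hεB : 0 ≤ εB)
    (hDA : ∀ μ x y a f, |A x (y + unitVec μ) a f - A x y a f| ≤ εA * Real.exp (-δ * l1 (x - y)))
    (hDB : ∀ μ y z f b, |B (y + unitVec μ) z f b - B y z f b| ≤ εB * Real.exp (-δ * l1 (y - z)))
    (hδ'0 : 0 < δ') (hδ' : δ' < δ) (hδ''0 : 0 ≤ δ'') (hδ'' : δ'' < δ') :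
    Decays (comp (comp A (blockFF (unitK sf sm (KInvStep (d := d) Lc j)))) B)
      ((Fintype.card (Fib d) : ℝ) *
        (((Fintype.card (Fib d) : ℝ) *
            (((((d : ℝ) + 2) * ((Lc : ℝ) - 1)) * εA * Real.exp (2 * δ * (((d : ℝ) + 2) * ((Lc : ℝ) - 1)))) * CΓ) *
              Zl (d + 1) (δ - δ')) *
          ((((d : ℝ) + 2) * ((Lc : ℝ) - 1)) * εB * Real.exp (2 * δ * (((d : ℝ) + 2) * ((Lc : ℝ) - 1))))) *
        Zl (d + 1) (δ' - δ'')) δ'' :=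
  decays_comp_comp_ffUnitKInvStep sf sm j hA hΓ hB hCB hδ (decays_sub_contourRefL (N := Lc) hεA hδ.le hDA)
    (decays_sub_contourRef (N := Lc) hεB hδ.le hDB) (osc_const_nonneg hεB) hδ'0 hδ' hδ''0 hδ''

end Summit.QuantumFields.BalabanUV.Beta.GAN24.WoodburyFibreZeroModeGainUnits

end
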